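import Summits.QuantumFields.YangMills.Theorems.AlphaInputsT3ACv3LinearLiftMatrix
import Summits.QuantumFields.YangMills.Theorems.AlphaInputsT3ACv3LinearAvgMatrix
import Mathlib.Analysis.Normed.Module.HahnBanach
import HarnessLib

/-!
# `AlphaInputsT3ACv3LinearLiftMatrixLift` — (V) THE MATRIX-VALUED PORT OF THE (LL) ENGINE, PART 2: the matrix linearised averages are the entrywise extensions of the
# scalar ones; ★★ the MATRIX-VALUED EXACT LINEAR LIFT `liftM` (exact on every coarse bond, `𝔰𝔲(N)`-valued on `𝔰𝔲(N)`-valued data, local curl bound `18^d·ε∕L^{2k}` with NO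
# group-dimension factor); the multi-level transfers `Lift_{t→s}` — cell `ym3-torus`, width seat `ym-ust-19936-w3` (g0); OWNER RULING g24-№4

WHY.  Part 1 (`…v3LinearLiftMatrix`) typed the seam (V) between the SCALAR (LL) engine of record (seat w2; regional twin seat alpha-2; k-uniform sup bounds seat w1) and the
MATRIX currency of the Newton candidates of RULING g24-№4 (`BlockAveragingEMLLinearised.linAvg`, w1's (B2)): `byEntry`, kernel form, submodule preservation, `ℓ^∞`-port.  HERE:
* §3a ★★ `norm_byEntry_le_of_linear_bound` — the DUALITY PORT: for LINEAR scalar operators `T`, `G`, «`|T f (b)| ≤ C·M` whenever `|G f (y)| ≤ M` on `N`» ports to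
  «`‖byEntry T A b‖ ≤ C·M` whenever `‖byEntry G A y‖ ≤ M` on `N`» with the SAME constant (curl-to-curl and sup-to-sup estimates of ANY linear regional lift port verbatim —
  Hahn–Banach `exists_dual_vector''` over `ℝ` + naturality `apply_byEntry`); this is the socket for ★alpha-2's `exists_linearLift_region` once its lift is a named linear operator.
* §3 ★ `linAvg_eq_byEntry` (`linAvg Y c = byEntry linAvg04 Y c`, from w1's `LinearAvgMatrix.apply_linAvg`); `linAvgIterM s` = the ITERATED matrix linearised average `Q₁^s`,
  ★ `linAvgIterM_eq_byEntry`, `linAvgIterM_mem`, `map_linAvgIterM`, `iterLin_eq_linAvgIterM` (w1's composite families `Q` ARE `linAvgIterM`), ★ `norm_linAvgIterM_le` ∕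
  `norm_iterLin_le'`: `‖(Q₁^s Y)(c)‖ ≤ (d+1)·L^s·δ` — w1's `abs_linAvgIter_le` ported WITHOUT the `2|n|²` of `LinearAvgMatrix.norm_iterLin_le`.
* §4 ★★ `liftM k A := byEntry (lift k) A`: EXACTNESS `linAvgIterM_liftM : linAvgIterM k (liftM k A) = A` on EVERY coarse bond of the torus, ★ `liftM_mem` (`𝔰𝔲(N)`-valued data
  lift to `𝔰𝔲(N)`-valued fields; any `ℝ`-submodule), `map_liftM`; the k-UNIFORM sup bounds `abs_lift_le` (scalar, `(d+1)·18^d·M`) and ★ `norm_liftM_le` (matrix, SAME constant);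
  the matrix lattice curl `curlM`, the `S²`-kernel `wS2` with ★ `sum_abs_wS2_le : Σ_y |w(x,y)| ≤ 18^d∕(L^k)²`, ★★ `curlM_liftM_eq_sum : curlM (liftM k A)(x;μ,ν) =
  Σ_y w(x,y) • curlM A (y;μ,ν)`, ★★ `norm_curlM_liftM_le_local`: `‖curlM (liftM k A)(x;μ,ν)‖ ≤ 18^d·ε∕(L^k)²` from `‖curlM A (y;μ,ν)‖ ≤ ε` at the coarse `y` NEAR `x` only
  (`LinearLiftSpread.Near`) — NO group-dimension factor; `norm_curlM_liftM_le`; ★★★ `exists_linearLiftM_torus`: (LL) for `S`-valued one-forms on the full torus, B_loc = 18^d.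
* §5 `LiftTS t s := linAvgIterM s ∘ liftM t` — the transfers `Lift_{t→s}` of the architecture memo (19936 evidence #52 §3): (T1a) `linAvg_LiftTS` (`rfl`), (T1b) `LiftTS_self`,
  `LiftTS_zero`, `LiftTS_mem`.
HONEST FRAMING.  Finite-dimensional real linear algebra over the lattice tori of [Balaban1987RG1] (0.1)–(0.4); nothing of [Balaban1985UV3]∕[Balaban1985Variational]∕
[Balaban1985Averaging] is asserted; (FL), the stub 2′χ `stub_laneRecordsV3Chi`, the crux `HistoryTailL` and any gap are NOT claimed; count-neutral helper
(`--supports stmt-QuantumFields-19936`); registry untouched.  YM₃ on the three-torus is a RUNG of the programme (UV stability ∕ continuum limit on T³), not the Clay problem;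
nothing here is about d = 4, infinite volume or a mass gap.

References: T. Bałaban, Commun. Math. Phys. 109 (1987) 249–301 [Balaban1987RG1] ((0.3)–(0.4) pp.252–253, (0.11) p.253); Commun. Math. Phys. 98 (1985) 17–51
[Balaban1985Averaging] ((9) p.19, (124)–(125) p.36); Commun. Math. Phys. 102 (1985) 277–309 [Balaban1985Variational] (Thm 1 (8) p.279: the `L^{−2k}` window the lift
realises); B. C. Hall, Lie Groups, Lie Algebras, and Representations (2015) [Hall2015] (Example 7.3: `𝔰𝔲(n)`).
-/

set_option autoImplicit false

noncomputable section

open scoped Matrix.Norms.L2Operator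

namespace Summit.QuantumFields.YangMills.Theorems.LinearLiftMatrix

open Finset
open Literature.MathematicalPhysics.QuantumFieldTheory.Balaban1983to89
open Literature.MathematicalPhysics.QuantumFieldTheory.Balaban1983to89.T4Continuum
open Literature.MathematicalPhysics.QuantumFieldTheory.Balaban1983to89.BlockAveragingEMLLinearised (linAvg)
open Literature.MathematicalPhysics.QuantumFieldTheory.Balaban1985CMP102.Setting
open Summit.QuantumFields.Balaban3D.Carriers
open Summit.QuantumFields.YangMills.Theorems.AbelianEML (linAvg04 linAvgIter linAvgIter_succ curlAt)
open Summit.QuantumFields.YangMills.Theorems.LinearLiftProfile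
open Summit.QuantumFields.YangMills.Theorems.LinearLiftSpread (hh S1 S2 lift Near weight_eq_zero_of_not_near abs_S2_le_local linAvgIter_lift curlAt_lift near_self)
open Summit.QuantumFields.YangMills.Theorems.LinearLiftGauge (dgrad psiIter)
open Summit.QuantumFields.YangMills.Theorems.LinearAvgMatrix (apply_linAvg apply_iterLin)
open Summit.QuantumFields.YangMills.Theorems.LinearAvgSup (abs_linAvgIter_le abs_S1_le abs_psiIter_le' abs_dgrad_le)
open Literature.MathematicalPhysics.QuantumFieldTheory.Balaban1983to89.B5Eq118OneStroke (iterBlockOf)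

variable {P : Params} {j : ℕ}

/-! ## §3a The duality port: bounds between LINEAR images (curl ↦ curl, value ↦ value) port with the same constant -/

section DualityPort

variable {n : Type*} {ι ι' κ : Type*} [Fintype ι] [DecidableEq ι]

/-- **NATURALITY FOR FUNCTIONALS**: `ψ (byEntry T A b) = T (ψ ∘ A) (b)` for a LINEAR scalar operator `T` and an `ℝ`-linear functional `ψ` on the coefficients.
[folklore] -/
theorem apply_byEntry (T : (ι → ℝ) →ₗ[ℝ] (κ → ℝ)) (ψ : Matrix n n ℂ →ₗ[ℝ] ℝ) (A : ι → Matrix n n ℂ) (b : κ) :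
    ψ (byEntry T A b) = T (fun c => ψ (A c)) b := by
  rw [map_byEntry, apply_eq_sum_kernel]
  simp only [smul_eq_mul]

variable [Fintype n] [DecidableEq n]

/-- **★★ THE DUALITY PORT, SAME CONSTANT**: let `T`, `G` be LINEAR scalar lattice operators and suppose the scalar estimate «`|T f (b)| ≤ C·M` whenever `|G f (y)| ≤ M` for
the `y` in a sub-family `N`» (e.g. `T = curl ∘ lift`, `G = curl`: a curl-to-curl bound; `G = id`: a sup bound).  Then the SAME estimate holds for matrix fields in the
operator norm: «`‖byEntry T A b‖ ≤ C·M` whenever `‖byEntry G A y‖ ≤ M` on `N`» — read the matrix inequality through a norming functional (Hahn–Banach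
`exists_dual_vector''` over `ℝ`) and use naturality on both sides.  No dimension-of-the-group factor, no kernel positivity needed. [folklore] -/
theorem norm_byEntry_le_of_linear_bound (T : (ι → ℝ) →ₗ[ℝ] (κ → ℝ)) (G : (ι → ℝ) →ₗ[ℝ] (ι' → ℝ)) (N : ι' → Prop) (b : κ) {C : ℝ}
    (hT : ∀ (f : ι → ℝ) (M : ℝ), (∀ y, N y → |G f y| ≤ M) → |T f b| ≤ C * M)
    (A : ι → Matrix n n ℂ) {M : ℝ} (hA : ∀ y, N y → ‖byEntry G A y‖ ≤ M) :
    ‖byEntry T A b‖ ≤ C * M := by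
  obtain ⟨g, hg1, hgx⟩ := exists_dual_vector'' ℝ (byEntry T A b)
  have hgle : ∀ Z : Matrix n n ℂ, |g Z| ≤ ‖Z‖ := fun Z => by
    rw [← Real.norm_eq_abs]
    exact (g.le_opNorm Z).trans (by nlinarith [norm_nonneg Z])
  have hyp : ∀ y, N y → |G (fun c => g (A c)) y| ≤ M := fun y hy => by
    rw [show G (fun c => g (A c)) y = g (byEntry G A y) from (apply_byEntry G (g : Matrix n n ℂ →ₗ[ℝ] ℝ) A y).symm]
    exact (hgle _).trans (hA y hy)
  have h := hT _ M hyp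
  rw [show T (fun c => g (A c)) b = g (byEntry T A b) from (apply_byEntry T (g : Matrix n n ℂ →ₗ[ℝ] ℝ) A b).symm] at h
  have hx : (g (byEntry T A b) : ℝ) = ‖byEntry T A b‖ := by simpa using hgx
  calc ‖byEntry T A b‖ = g (byEntry T A b) := hx.symm
    _ ≤ |g (byEntry T A b)| := le_abs_self _
    _ ≤ C * M := h
end DualityPort

/-! ## §3 The matrix linearised averages are the entrywise extensions of the scalar ones -/

section MatrixAverages

variable {n : Type*}

/-- The real part of an entry is an `ℝ`-linear functional. [folklore] -/
def reEntry (n : Type*) (i l : n) : Matrix n n ℂ →ₗ[ℝ] ℝ where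
  toFun M := (M i l).re
  map_add' M N := by simp
  map_smul' r M := by simp

/-- The imaginary part of an entry is an `ℝ`-linear functional. [folklore] -/
def imEntry (n : Type*) (i l : n) : Matrix n n ℂ →ₗ[ℝ] ℝ where
  toFun M := (M i l).im
  map_add' M N := by simp
  map_smul' r M := by simp

/-- `reEntry` unfolded. [folklore] -/
@[simp] theorem reEntry_apply (i l : n) (M : Matrix n n ℂ) : reEntry n i l M = (M i l).re := rfl

/-- `imEntry` unfolded. [folklore] -/
@[simp] theorem imEntry_apply (i l : n) (M : Matrix n n ℂ) : imEntry n i l M = (M i l).im := rfl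

/-- **★ THE MATRIX LINEARISED (0.4) AVERAGE IS THE ENTRYWISE EXTENSION OF THE SCALAR ONE**: `linAvg Y c = byEntry linAvg04 Y c`.
[cite: Balaban1985Averaging, (124)-(125) p.36; Balaban1987RG1, (0.4) p.253] -/
theorem linAvg_eq_byEntry [Fintype n] [DecidableEq n] [Nonempty n] (Y : PBond P j → Matrix n n ℂ) (c : PBond P (j + 1)) : linAvg Y c = byEntry linAvg04 Y c := by
  ext i l
  apply Complex.ext
  · rw [byEntry_apply_re]
    exact apply_linAvg (reEntry n i l) Y c
  · rw [byEntry_apply_im]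
    exact apply_linAvg (imEntry n i l) Y c

/-- **THE ITERATED MATRIX LINEARISED (0.4) AVERAGE** from the finest level to level `s` (`Q₁` iterated). [cite: Balaban1987RG1, (0.11) p.253] -/
def linAvgIterM : (s : ℕ) → (PBond P 0 → Matrix n n ℂ) → (PBond P s → Matrix n n ℂ)
  | 0 => id
  | s + 1 => fun Y c => linAvg (linAvgIterM s Y) c

/-- `linAvgIterM 0 = id`. [cite: Balaban1987RG1, (0.11) p.253] -/
@[simp] theorem linAvgIterM_zero (Y : PBond P 0 → Matrix n n ℂ) : linAvgIterM 0 Y = Y := rfl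

/-- `linAvgIterM (s+1) Y c = linAvg (linAvgIterM s Y) c`. [cite: Balaban1987RG1, (0.11) p.253] -/
theorem linAvgIterM_succ (s : ℕ) (Y : PBond P 0 → Matrix n n ℂ) (c : PBond P (s + 1)) :
    linAvgIterM (s + 1) Y c = linAvg (linAvgIterM s Y) c := rfl

/-- **★ THE ITERATED MATRIX AVERAGE IS THE ENTRYWISE EXTENSION OF THE ITERATED SCALAR AVERAGE**: `linAvgIterM s = byEntry (linAvgIter s)`. [cite: Balaban1987RG1, (0.11) p.253] -/
theorem linAvgIterM_eq_byEntry [Fintype n] [DecidableEq n] [Nonempty n] : ∀ (s : ℕ) (Y : PBond P 0 → Matrix n n ℂ), linAvgIterM s Y = byEntry (linAvgIter s) Y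
  | 0, Y => by rw [linAvgIterM_zero]; exact (byEntry_id Y).symm
  | s + 1, Y => by
    funext c
    rw [linAvgIterM_succ, linAvgIterM_eq_byEntry s Y, linAvg_eq_byEntry, byEntry_comp]
    rfl

/-- The iterated matrix average preserves every `ℝ`-submodule of the coefficients (e.g. `𝔰𝔲(N)`-valued fields average to `𝔰𝔲(N)`-valued fields). [folklore] -/
theorem linAvgIterM_mem [Fintype n] [DecidableEq n] [Nonempty n] (s : ℕ) (S : Submodule ℝ (Matrix n n ℂ)) {Y : PBond P 0 → Matrix n n ℂ} (hY : ∀ b, Y b ∈ S) (c : PBond P s) :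
    linAvgIterM s Y c ∈ S := by
  classical
  rw [linAvgIterM_eq_byEntry, byEntry_congr (fun f => (linAvgIterL_apply s f).symm)]
  exact byEntry_mem (linAvgIterL P s) S hY c

/-- The iterated matrix average commutes with every `ℝ`-linear endomorphism of the coefficients applied pointwise. [folklore] -/
theorem map_linAvgIterM [Fintype n] [DecidableEq n] [Nonempty n] (s : ℕ) (ψ : Matrix n n ℂ →ₗ[ℝ] Matrix n n ℂ) (Y : PBond P 0 → Matrix n n ℂ) (c : PBond P s) :
    ψ (linAvgIterM s Y c) = linAvgIterM s (fun b => ψ (Y b)) c := by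
  classical
  rw [linAvgIterM_eq_byEntry, linAvgIterM_eq_byEntry, byEntry_congr (fun f => (linAvgIterL_apply s f).symm),
    byEntry_congr (T := linAvgIter s) (fun f => (linAvgIterL_apply s f).symm)]
  exact map_byEntry_eq (linAvgIterL P s) ψ Y c

/-- Every family of composites of `linAvg` (w1's characterisation in `LinearAvgMatrix.apply_iterLin`: `Q 0 = id`, `Q (s+1) Y c = linAvg (Q s Y) c`) IS `linAvgIterM`.
[cite: Balaban1987RG1, (0.11) p.253] -/
theorem iterLin_eq_linAvgIterM (Q : (i : ℕ) → (PBond P 0 → Matrix n n ℂ) → PBond P i → Matrix n n ℂ)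
    (hQ0 : ∀ Y, Q 0 Y = Y) (hQs : ∀ (i : ℕ) (Y : PBond P 0 → Matrix n n ℂ) (c : PBond P (i + 1)), Q (i + 1) Y c = linAvg (Q i Y) c) (Y : PBond P 0 → Matrix n n ℂ) :
    ∀ s : ℕ, Q s Y = linAvgIterM s Y
  | 0 => hQ0 Y
  | s + 1 => by
    funext c
    rw [hQs, linAvgIterM_succ, iterLin_eq_linAvgIterM Q hQ0 hQs Y s]

/-- **★ THE `s`-UNIFORM SUP BOUND OF THE MATRIX ITERATES, NO GROUP-DIMENSION FACTOR**: `‖Y_b‖ ≤ δ` on every finest bond ⇒ `‖(Q₁^s Y)(c)‖ ≤ (d+1)·L^s·δ` — w1's scalar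
`LinearAvgSup.abs_linAvgIter_le` ported through `norm_byEntry_le_of_bound` (compare `LinearAvgMatrix.norm_iterLin_le`: the same with an extra `2|n|²`).
[cite: Balaban1985Averaging, Prop. 4 (130)–(131) p.38; Balaban1987RG1, (0.11) p.253] -/
theorem norm_linAvgIterM_le [Fintype n] [DecidableEq n] [Nonempty n] (s : ℕ) (Y : PBond P 0 → Matrix n n ℂ) {δ : ℝ} (hY : ∀ b, ‖Y b‖ ≤ δ) (c : PBond P s) :
    ‖linAvgIterM s Y c‖ ≤ (((P.d : ℝ) + 1) * (P.L : ℝ) ^ s) * δ := by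
  classical
  have hδ : 0 ≤ δ := (norm_nonneg _).trans (hY ⟨fun _ => 0, c.dir⟩)
  rw [linAvgIterM_eq_byEntry, byEntry_congr (T := linAvgIter s) (fun f => (linAvgIterL_apply s f).symm)]
  exact norm_byEntry_le_of_bound (linAvgIterL P s) (fun _ => True) c (fun f M hf => abs_linAvgIter_le f (fun b => hf b trivial) s c) Y hδ fun b _ => hY b

/-- The same bound for any family of composites of `linAvg` (w1's `Q`). [cite: Balaban1987RG1, (0.11) p.253] -/
theorem norm_iterLin_le' [Fintype n] [DecidableEq n] [Nonempty n] (Q : (i : ℕ) → (PBond P 0 → Matrix n n ℂ) → PBond P i → Matrix n n ℂ)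
    (hQ0 : ∀ Y, Q 0 Y = Y) (hQs : ∀ (i : ℕ) (Y : PBond P 0 → Matrix n n ℂ) (c : PBond P (i + 1)), Q (i + 1) Y c = linAvg (Q i Y) c)
    (Y : PBond P 0 → Matrix n n ℂ) {δ : ℝ} (hY : ∀ b, ‖Y b‖ ≤ δ) (s : ℕ) (c : PBond P s) :
    ‖Q s Y c‖ ≤ (((P.d : ℝ) + 1) * (P.L : ℝ) ^ s) * δ := by
  rw [iterLin_eq_linAvgIterM Q hQ0 hQs Y s]
  exact norm_linAvgIterM_le s Y hY c
end MatrixAverages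

/-! ## §4 The matrix-valued exact linear lift -/

section MatrixLift

variable {n : Type*}

/-- **THE MATRIX-VALUED EXACT LINEAR LIFT** of a coarse `M_n(ℂ)`-valued one-form: w2's `lift k` on the real and imaginary part of every entry. [cite: Balaban1987RG1, (0.4)+(0.11) p.253] -/
def liftM (k : ℕ) (A : PBond P k → Matrix n n ℂ) : PBond P 0 → Matrix n n ℂ := byEntry (lift k) A

/-- `liftM` is `byEntry (lift k)`. [cite: Balaban1987RG1, (0.4)+(0.11) p.253] -/
theorem liftM_eq (k : ℕ) (A : PBond P k → Matrix n n ℂ) : liftM k A = byEntry (lift k) A := rfl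

variable (k : ℕ) (hk : k ≤ P.m + P.K)
include hk

/-- **★★ EXACTNESS OF THE MATRIX LIFT**: `linAvgIterM k (liftM k A) = A` — the `k`-fold MATRIX linearised (0.4) average of the lift IS the coarse matrix one-form, on EVERY coarse
bond of the torus (for a region: extend `A` off `Ω` arbitrarily; exactness on `bondsIn k Ω` a fortiori). [cite: Balaban1987RG1, (0.4)+(0.11) p.253] -/
theorem linAvgIterM_liftM [Fintype n] [DecidableEq n] [Nonempty n] (A : PBond P k → Matrix n n ℂ) : linAvgIterM k (liftM k A) = A := by
  rw [linAvgIterM_eq_byEntry, liftM_eq, byEntry_comp]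
  have h : ((linAvgIter k) ∘ (lift k) : (PBond P k → ℝ) → (PBond P k → ℝ)) = id := funext fun f => linAvgIter_lift k hk f
  rw [h, byEntry_id]

omit hk in
/-- **★ `𝔰𝔲(N)`-VALUED DATA LIFT TO `𝔰𝔲(N)`-VALUED FIELDS** (and likewise for every `ℝ`-submodule of `M_n(ℂ)`). [cite: Hall2015, Example 7.3] -/
theorem liftM_mem (S : Submodule ℝ (Matrix n n ℂ)) {A : PBond P k → Matrix n n ℂ} (hA : ∀ c, A c ∈ S) (b : PBond P 0) : liftM k A b ∈ S := by
  classical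
  rw [liftM_eq, byEntry_congr (fun f => (liftL_apply k f).symm)]
  exact byEntry_mem (liftL P k) S hA b

omit hk in
/-- The matrix lift commutes with every `ℝ`-linear endomorphism of the coefficients applied pointwise (`Ad` of a constant group element, change of basis). [folklore] -/
theorem map_liftM (ψ : Matrix n n ℂ →ₗ[ℝ] Matrix n n ℂ) (A : PBond P k → Matrix n n ℂ) (b : PBond P 0) :
    ψ (liftM k A b) = liftM k (fun c => ψ (A c)) b := by
  classical
  rw [liftM_eq, liftM_eq, byEntry_congr (fun f => (liftL_apply k f).symm), byEntry_congr (T := lift k) (fun f => (liftL_apply k f).symm)]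
  exact map_byEntry_eq (liftL P k) ψ A b

omit hk in
/-- **THE k-UNIFORM SUP BOUND OF THE SCALAR EXACT LIFT**: `|A| ≤ M` on the coarse bonds ⇒ `|lift k A| ≤ (d+1)·18^d·M` on the finest bonds (`|S¹A| ≤ 18^d M∕L^k` and
`|Ψ_k(S¹A)| ≤ (d∕2)(L^k − 1)·18^d M∕L^k` from w1's `…v3LinearAvgSup`, `|dg| ≤ 2 sup|g|`). [cite: Balaban1987RG1, (0.4)+(0.11) p.253] -/
theorem abs_lift_le (A : PBond P k → ℝ) {M : ℝ} (hM : ∀ c, |A c| ≤ M) (b : PBond P 0) :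
    |lift k A b| ≤ (((P.d : ℝ) + 1) * (18 : ℝ) ^ P.d) * M := by
  have hM0 : 0 ≤ M := (abs_nonneg _).trans (hM ⟨fun _ => 0, b.dir⟩)
  have hL1 : (1 : ℝ) ≤ (P.L : ℝ) ^ k := one_le_pow₀ (by exact_mod_cast P.L_pos)
  have hLk : (0 : ℝ) < (P.L : ℝ) ^ k := by positivity
  have hS1 : ∀ b' : PBond P 0, |S1 k A b'| ≤ (18 : ℝ) ^ P.d * M / (P.L : ℝ) ^ k := fun b' => abs_S1_le k A hM b'
  have hX : (18 : ℝ) ^ P.d * M / (P.L : ℝ) ^ k ≤ (18 : ℝ) ^ P.d * M := div_le_self (by positivity) hL1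
  have hψ : ∀ x : Site P 0, |(fun x : Site P 0 => -psiIter k (S1 k A) (iterBlockOf k x)) x| ≤
      (P.d : ℝ) / 2 * ((P.L : ℝ) ^ k - 1) * ((18 : ℝ) ^ P.d * M / (P.L : ℝ) ^ k) := fun x => by
    rw [abs_neg]; exact abs_psiIter_le' (S1 k A) hS1 k _
  have hd := abs_dgrad_le _ hψ b
  have hfrac : ((P.L : ℝ) ^ k - 1) * ((18 : ℝ) ^ P.d * M / (P.L : ℝ) ^ k) ≤ (18 : ℝ) ^ P.d * M := by
    rw [← mul_div_assoc, div_le_iff₀ hLk]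
    nlinarith [hM0, pow_nonneg (show (0 : ℝ) ≤ 18 by norm_num) P.d]
  have hd' : |dgrad (fun x : Site P 0 => -psiIter k (S1 k A) (iterBlockOf k x)) b| ≤ (P.d : ℝ) * ((18 : ℝ) ^ P.d * M) := by
    refine hd.trans ?_
    have hd0 : (0 : ℝ) ≤ P.d := Nat.cast_nonneg _
    nlinarith [hfrac, hd0]
  unfold lift
  rw [Pi.sub_apply]
  calc |S1 k A b - dgrad (fun x : Site P 0 => -psiIter k (S1 k A) (iterBlockOf k x)) b|
      ≤ |S1 k A b| + |dgrad (fun x : Site P 0 => -psiIter k (S1 k A) (iterBlockOf k x)) b| := abs_sub _ _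
    _ ≤ (18 : ℝ) ^ P.d * M + (P.d : ℝ) * ((18 : ℝ) ^ P.d * M) := add_le_add ((hS1 b).trans hX) hd'
    _ = (((P.d : ℝ) + 1) * (18 : ℝ) ^ P.d) * M := by ring

omit hk in
/-- **★ THE k-UNIFORM SUP BOUND OF THE MATRIX LIFT, NO GROUP-DIMENSION FACTOR**: `‖A c‖ ≤ M` on the coarse bonds ⇒ `‖liftM k A b‖ ≤ (d+1)·18^d·M` on the finest bonds
(`abs_lift_le` ported through `norm_byEntry_le_of_bound`) — the operator norm of the Newton right inverse is bounded uniformly in `k`. [cite: Balaban1987RG1, (0.4)+(0.11) p.253] -/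
theorem norm_liftM_le [Fintype n] [DecidableEq n] (A : PBond P k → Matrix n n ℂ) {M : ℝ} (hA : ∀ c, ‖A c‖ ≤ M) (b : PBond P 0) :
    ‖liftM k A b‖ ≤ (((P.d : ℝ) + 1) * (18 : ℝ) ^ P.d) * M := by
  classical
  have hM : 0 ≤ M := (norm_nonneg _).trans (hA ⟨fun _ => 0, b.dir⟩)
  rw [liftM_eq, byEntry_congr (T := lift k) (fun f => (liftL_apply k f).symm)]
  exact norm_byEntry_le_of_bound (liftL P k) (fun _ => True) b (fun f M' hf => abs_lift_le k f (fun c => hf c trivial) b) A hM fun c _ => hA c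

omit hk

/-- **THE MATRIX LATTICE CURL** of an `M_n(ℂ)`-valued one-form at `(x; μ, ν)`: `Y(x,μ) + Y(x+e_μ,ν) − Y(x+e_ν,μ) − Y(x,ν)` (the linear part of the plaquette variable;
entrywise `AbelianEML.curlAt`). [cite: Balaban1985Averaging, (9) p.19] -/
def curlM {j : ℕ} (Y : PBond P j → Matrix n n ℂ) (x : Site P j) (μ ν : Fin P.d) : Matrix n n ℂ :=
  Y ⟨x, μ⟩ + Y ⟨x.shift μ, ν⟩ - Y ⟨x.shift ν, μ⟩ - Y ⟨x, ν⟩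

/-- The real part of an entry of the matrix curl is the scalar curl of the real parts. [folklore] -/
theorem curlM_apply_re {j : ℕ} (Y : PBond P j → Matrix n n ℂ) (x : Site P j) (μ ν : Fin P.d) (i l : n) :
    (curlM Y x μ ν i l).re = curlAt (fun b => (Y b i l).re) x μ ν := by
  simp only [curlM, curlAt, Matrix.add_apply, Matrix.sub_apply, Complex.add_re, Complex.sub_re]

/-- The imaginary part of an entry of the matrix curl is the scalar curl of the imaginary parts. [folklore] -/
theorem curlM_apply_im {j : ℕ} (Y : PBond P j → Matrix n n ℂ) (x : Site P j) (μ ν : Fin P.d) (i l : n) :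
    (curlM Y x μ ν i l).im = curlAt (fun b => (Y b i l).im) x μ ν := by
  simp only [curlM, curlAt, Matrix.add_apply, Matrix.sub_apply, Complex.add_im, Complex.sub_im]

/-- The `S²`-weight of the coarse site `y` at the finest site `x` for the direction pair `(μ, ν)`. [folklore] -/
def wS2 (k : ℕ) (x : Site P 0) (μ ν : Fin P.d) (y : Site P k) : ℝ :=
  Ptau (hh P k) (x μ) (y μ) * Ptau (hh P k) (x ν) (y ν) * ∏ i ∈ (univ.erase μ).erase ν, Psig (hh P k) (x i) (y i)

/-- `S2` in kernel form. [folklore] -/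
theorem S2_eq_sum_wS2 (G : Site P k → Fin P.d → Fin P.d → ℝ) (x : Site P 0) (μ ν : Fin P.d) :
    S2 k G x μ ν = ∑ y, wS2 k x μ ν y * G y μ ν := by
  unfold S2 wS2
  exact sum_congr rfl fun y _ => by ring

/-- **THE `ℓ¹`-MASS OF THE LOCAL `S²`-KERNEL**: `Σ_{y near x} |w(x,y)| ≤ 18^d ∕ (L^k)²` (w2's `abs_S2_le_local` tested on the sign pattern of the kernel). [folklore] -/
theorem sum_abs_wS2_le (hk : k ≤ P.m + P.K) (x : Site P 0) {μ ν : Fin P.d} (hμν : μ ≠ ν) :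
    ∑ y, |wS2 k x μ ν y| ≤ (18 : ℝ) ^ P.d * 1 / ((P.L : ℝ) ^ k) ^ 2 := by
  let G : Site P k → Fin P.d → Fin P.d → ℝ := fun y _ _ => if 0 ≤ wS2 k x μ ν y then 1 else -1
  have hG : ∀ y : Site P k, Near k x y → |G y μ ν| ≤ 1 := fun y _ => by
    by_cases h : 0 ≤ wS2 k x μ ν y
    · simp [G, if_pos h]
    · simp [G, if_neg h]
  have h := abs_S2_le_local k hk G x hμν hG
  rw [S2_eq_sum_wS2] at h
  have hsum : ∑ y, wS2 k x μ ν y * G y μ ν = ∑ y, |wS2 k x μ ν y| := sum_congr rfl fun y _ => by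
    by_cases h0 : 0 ≤ wS2 k x μ ν y
    · simp only [G, if_pos h0, mul_one, abs_of_nonneg h0]
    · simp only [G, if_neg h0, mul_neg, mul_one, abs_of_neg (lt_of_not_ge h0)]
  rw [hsum] at h
  exact (le_abs_self _).trans h

include hk

/-- **★★ THE MATRIX CURL OF THE MATRIX LIFT IS THE `S²`-SPREAD OF THE COARSE MATRIX CURLS**: `curlM (liftM k A) (x; μ, ν) = Σ_y w(x,y) • curlM A (y; μ, ν)` (`μ ≠ ν`;
entrywise `curlAt_lift`). [cite: Balaban1987RG1, (0.4) p.253] -/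
theorem curlM_liftM_eq_sum (A : PBond P k → Matrix n n ℂ) (x : Site P 0) {μ ν : Fin P.d} (hμν : μ ≠ ν) :
    curlM (liftM k A) x μ ν = ∑ y, (wS2 k x μ ν y) • curlM A y μ ν := by
  ext i l
  apply Complex.ext
  · rw [curlM_apply_re, Matrix.sum_apply, Complex.re_sum]
    have h : (fun b => (liftM k A b i l).re) = lift k (fun c => (A c i l).re) := funext fun b => byEntry_apply_re _ _ _ _ _
    rw [h, curlAt_lift k hk _ x hμν, S2_eq_sum_wS2]
    refine sum_congr rfl fun y _ => ?_
    rw [Matrix.smul_apply, Complex.smul_re, smul_eq_mul, curlM_apply_re]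
  · rw [curlM_apply_im, Matrix.sum_apply, Complex.im_sum]
    have h : (fun b => (liftM k A b i l).im) = lift k (fun c => (A c i l).im) := funext fun b => byEntry_apply_im _ _ _ _ _
    rw [h, curlAt_lift k hk _ x hμν, S2_eq_sum_wS2]
    refine sum_congr rfl fun y _ => ?_
    rw [Matrix.smul_apply, Complex.smul_im, smul_eq_mul, curlM_apply_im]

/-- **★★ THE LOCAL CURL BOUND OF THE MATRIX LIFT, NO GROUP-DIMENSION FACTOR**: `‖curlM (liftM k A) (x; μ, ν)‖ ≤ 18^d · ε ∕ (L^k)²` as soon as `‖curlM A (y; μ, ν)‖ ≤ ε` at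
the coarse sites `y` NEAR `x` (`LinearLiftSpread.Near`: the `3^d`-cell neighbourhood of `x`'s `k`-cell) — interior cells of any union of `k`-cells inherit the bound from a
hypothesis on the 1-cell thickening only. [cite: Balaban1987RG1, (0.4) p.253; Balaban1985Variational, Thm 1 (8) p.279] -/
theorem norm_curlM_liftM_le_local [Fintype n] [DecidableEq n] (A : PBond P k → Matrix n n ℂ) (x : Site P 0) {μ ν : Fin P.d} (hμν : μ ≠ ν) {ε : ℝ}
    (hA : ∀ y : Site P k, Near k x y → ‖curlM A y μ ν‖ ≤ ε) :
    ‖curlM (liftM k A) x μ ν‖ ≤ (18 : ℝ) ^ P.d * ε / ((P.L : ℝ) ^ k) ^ 2 := by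
  have hε : 0 ≤ ε := (norm_nonneg _).trans (hA _ (near_self k hk x))
  rw [curlM_liftM_eq_sum k hk A x hμν]
  have hterm : ∀ y, ‖(wS2 k x μ ν y) • curlM A y μ ν‖ ≤ |wS2 k x μ ν y| * ε := fun y => by
    rw [norm_smul, Real.norm_eq_abs]
    by_cases hy : Near k x y
    · exact mul_le_mul_of_nonneg_left (hA y hy) (abs_nonneg _)
    · rw [show wS2 k x μ ν y = 0 from weight_eq_zero_of_not_near k x y μ ν hμν hy, abs_zero, zero_mul, zero_mul]
  calc ‖∑ y, (wS2 k x μ ν y) • curlM A y μ ν‖ ≤ ∑ y, |wS2 k x μ ν y| * ε := norm_sum_le_of_le _ fun y _ => hterm y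
    _ = (∑ y, |wS2 k x μ ν y|) * ε := by rw [sum_mul]
    _ ≤ ((18 : ℝ) ^ P.d * 1 / ((P.L : ℝ) ^ k) ^ 2) * ε := mul_le_mul_of_nonneg_right (sum_abs_wS2_le k hk x hμν) hε
    _ = (18 : ℝ) ^ P.d * ε / ((P.L : ℝ) ^ k) ^ 2 := by ring

/-- **THE GLOBAL CURL BOUND OF THE MATRIX LIFT**: `‖curlM A‖ ≤ ε` everywhere ⇒ `‖curlM (liftM k A)‖ ≤ 18^d · ε ∕ (L^k)²` everywhere. [cite: Balaban1987RG1, (0.4) p.253] -/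
theorem norm_curlM_liftM_le [Fintype n] [DecidableEq n] (A : PBond P k → Matrix n n ℂ) {ε : ℝ} (hA : ∀ (y : Site P k) (μ ν : Fin P.d), μ ≠ ν → ‖curlM A y μ ν‖ ≤ ε)
    (x : Site P 0) {μ ν : Fin P.d} (hμν : μ ≠ ν) :
    ‖curlM (liftM k A) x μ ν‖ ≤ (18 : ℝ) ^ P.d * ε / ((P.L : ℝ) ^ k) ^ 2 :=
  norm_curlM_liftM_le_local k hk A x hμν fun y _ => hA y μ ν hμν

/-- **★★★ (LL) FOR `𝔰𝔲(N)`-VALUED ONE-FORMS ON THE FULL TORUS**: every coarse `𝔰𝔲(N)`-valued one-form `A` with matrix curls bounded by `ε` is the EXACT `k`-fold matrix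
linearised (0.4) average of a finest `𝔰𝔲(N)`-valued one-form with matrix curls bounded by `18^d · ε ∕ (L^k)²` — w2's `exists_linearLift_torus` in the currency of the
non-abelian candidates. [cite: Balaban1987RG1, (0.4)+(0.11) p.253; Balaban1985Variational, Thm 1 (8) p.279] -/
theorem exists_linearLiftM_torus [Fintype n] [DecidableEq n] [Nonempty n] (S : Submodule ℝ (Matrix n n ℂ)) (A : PBond P k → Matrix n n ℂ) (hAS : ∀ c, A c ∈ S) {ε : ℝ}
    (hA : ∀ (y : Site P k) (μ ν : Fin P.d), μ ≠ ν → ‖curlM A y μ ν‖ ≤ ε) :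
    ∃ a : PBond P 0 → Matrix n n ℂ, (∀ b, a b ∈ S) ∧ linAvgIterM k a = A ∧
      ∀ (x : Site P 0) (μ ν : Fin P.d), μ ≠ ν → ‖curlM a x μ ν‖ ≤ (18 : ℝ) ^ P.d * ε / ((P.L : ℝ) ^ k) ^ 2 :=
  ⟨liftM k A, liftM_mem k S hAS, linAvgIterM_liftM k hk A, fun x _ _ hμν => norm_curlM_liftM_le k hk A hA x hμν⟩
end MatrixLift

/-! ## §5 The multi-level transfer operators `Lift_{t→s}` of the architecture memo -/

section Transfer

variable {n : Type*}

/-- **THE MULTI-LEVEL TRANSFER** `Lift_{t→s} A := linAvgIterM s (liftM t A)`: lift the level-`t` matrix one-form to the finest torus, then average `s`-fold (19936 evidence #52 §3).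
[cite: Balaban1987RG1, (0.4)+(0.11) p.253] -/
def LiftTS (t s : ℕ) (A : PBond P t → Matrix n n ℂ) : PBond P s → Matrix n n ℂ := linAvgIterM s (liftM t A)

/-- (T1a) one more average moves the transfer one level up: `linAvg (Lift_{t→s} A) c = Lift_{t→s+1} A c`. [cite: Balaban1987RG1, (0.11) p.253] -/
theorem linAvg_LiftTS (t s : ℕ) (A : PBond P t → Matrix n n ℂ) (c : PBond P (s + 1)) : linAvg (LiftTS t s A) c = LiftTS t (s + 1) A c := rfl

/-- (T1b) at the top the transfer is the identity: `Lift_{t→t} A = A`. [cite: Balaban1987RG1, (0.4)+(0.11) p.253] -/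
theorem LiftTS_self [Fintype n] [DecidableEq n] [Nonempty n] (t : ℕ) (ht : t ≤ P.m + P.K) (A : PBond P t → Matrix n n ℂ) : LiftTS t t A = A := linAvgIterM_liftM t ht A

/-- `Lift_{t→0} = liftM t`. [cite: Balaban1987RG1, (0.4) p.253] -/
theorem LiftTS_zero (t : ℕ) (A : PBond P t → Matrix n n ℂ) : LiftTS t 0 A = liftM t A := rfl

/-- The transfers are `S`-valued on `S`-valued data for every `ℝ`-submodule `S` (e.g. `𝔰𝔲(N)`). [cite: Hall2015, Example 7.3] -/
theorem LiftTS_mem [Fintype n] [DecidableEq n] [Nonempty n] (t s : ℕ) (S : Submodule ℝ (Matrix n n ℂ)) {A : PBond P t → Matrix n n ℂ} (hA : ∀ c, A c ∈ S) (c : PBond P s) :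
    LiftTS t s A c ∈ S :=
  linAvgIterM_mem s S (fun b => liftM_mem t S hA b) c
end Transfer

end Summit.QuantumFields.YangMills.Theorems.LinearLiftMatrix

end
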